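import Mathlib
import HarnessLib
import Summits.HubbardSuperconductivity.HubbardSuperconductivity.Theorems.KLProgrammeKLRegimeEngineTowerBlockIncrWtKit

/-!
# Route `KLProgramme` — crux K3 ENGINE (stmt-HubbardSuperconductivity-20437 `KLRegimeEngineV17F2`), stub (b) v2, THE LEVELS PACKAGE (ℓ):
# instantiation (I1), THE MODEL Hstep IN KIT FORM ON THE CARRIERS — `klTowerBornWtAt ≤ kit right side (ε · klTowerMeasWtAt)`
# (continuation of `…EngineTowerBlockIncrWtKit`; E1-LEVELS-BLUEPRINT-g8 §2 carriers `klTowerBornWtAt` / `klTowerMeasWtAt` (…TowerModelDefsRate, p577964),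
#  E1 g8 HANDOFF «shapes: N(δ) := ε^{2δ}·B(δ), B 0 := 0»; cell gate-hubbard-kl, seat hubbard-kl-k3c3-p2 g13 as substitute typer; located «(I1)-HSTEP-KIT-FORM»)

`…TowerBlockIncrWtKit` bounds every born weighted pinned sum of `Δ_k` by the kit's step right side in absolute input sizes `N m′ = ε^{2m′}·B m′`, for ANY
majorants `B` of the un-normalised input pinned sums.  Here the input majorant is THE CARRIER: `B m′ := klTowerMeasWtAt … d k j (2m′) / ε^{2m′−1}`
(`klWtPinnedSumAt_le_klTowerMeasWtAt`; degree `0` is an empty supremum, so `B 0 = 0`), whence `N m′ = ε · klTowerMeasWtAt … d k j (2m′)`; and the output side is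
taken to its supremum over pins (`ciSup_le`):

* `klTowerMeasWtAt_zero`, `klTowerBornWtAt_zero` — the degree-`0` carriers vanish (empty pin type);
* `towerInputMajorant_of_klTowerMeasWtAt` — the carrier majorant satisfies p578846's `hB` (division by `ε^{2m′−1} > 0`);
* **`klTowerBornWtAt_le_kit`** — binder version: `klTowerBornWtAt … d k j (2(q+1)) ≤ ε^{2q+1}·cr·cc^{2q+1}·(towerFO D κ² N (q+1) + Σ_{n∈Icc 2 (N₀−1)} e·Φ^{n−1}·ψ^{q+1}·
  towerS D τ N n (q+1) + ψ^{q+1}·e·towerV D τ N·(Φ·towerV D τ N)^{N₀−1}/(1 − Φ·towerV D τ N))`, `N m′ := ε·klTowerMeasWtAt … d k j (2m′)`, kit guard on `N`;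
* **`klTowerBornWtAt_le_klEng_all_kit`** — the window-free flow-frame version (constants by equational binders, every block, no depth window).
What is left of (I1) on the weighted track after this file: divide by the output unit (`kitStep_units`) in the carriers' unit convention and read `σ̂ τ̂ Φ̂ ψ̂` as the
k-free numbers of E1-TOWER-BLOCKED §4 from the equational binders ((I1-dim), E1).  Compositions of landed theorems; nothing about the model is asserted beyond them;
nothing asserts any stub, (ℓ), K3 or superconductivity.
References: BGM 2006 §2.8 (2.77), (2.81)–(2.83), §3 (3.2)–(3.8) [cite: BenfattoGiulianiMastropietro2006].
-/

noncomputable section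

namespace Summit.HubbardSuperconductivity.HubbardSuperconductivity.Theorems.EngineV8

set_option linter.dupNamespace false -- summit = problem name (single-conjunct summit), D-0017

open Real Finset Literature.MathematicalPhysics.QuantumLattice Literature.Probability.LatticeModels GrassmannAlgebra
open Literature.MathematicalPhysics.QuantumLattice.BandSectorCounting
open Summit.HubbardSuperconductivity.HubbardSuperconductivity.Theorems.KLProgrammeLegKernels
open Summit.HubbardSuperconductivity.HubbardSuperconductivity.Theorems.KLRegimeSplit
open Summit.HubbardSuperconductivity.HubbardSuperconductivity.Theorems.KLRegimeWick
open Summit.HubbardSuperconductivity.HubbardSuperconductivity.Theorems.TwoPointAssembly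
open Summit.HubbardSuperconductivity.HubbardSuperconductivity.Theorems.TorusFourierL2
open Summit.HubbardSuperconductivity.HubbardSuperconductivity.Theorems.DispersionFlow
open Literature.Probability.LatticeModels.BattleFederbush

variable {L M : ℕ} [NeZero L]

/-! ## §1 Degree `0`: the carriers are empty suprema -/

/-- The measured weighted carrier vanishes in degree `0` (no leg to pin: `Fin 0 × _` is empty). -/
theorem klTowerMeasWtAt_zero (β U μ : ℝ) (K : TrigPolyC4v) (d k j : ℕ) : klTowerMeasWtAt L M β U μ K d k j 0 = 0 := by
  unfold klTowerMeasWtAt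
  haveI : IsEmpty (Fin 0 × (SpaceTimeIdx L M × SectorLeg (sectorCount (d * k - 1)))) := by infer_instance
  rw [Real.iSup_of_isEmpty]

/-- The born weighted carrier vanishes in degree `0`. -/
theorem klTowerBornWtAt_zero (β U μ : ℝ) (K : TrigPolyC4v) (d k j : ℕ) : klTowerBornWtAt L M β U μ K d k j 0 = 0 := by
  unfold klTowerBornWtAt
  haveI : IsEmpty (Fin 0 × (SpaceTimeIdx L M × SectorLeg (sectorCount (d * k)))) := by infer_instance
  rw [Real.iSup_of_isEmpty]

/-- Nonnegativity of the measured weighted carrier at rate `j` (`0 ≤ β`). -/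
theorem klTowerMeasWtAt_nonneg {β : ℝ} (hβ : 0 ≤ β) (U μ : ℝ) (K : TrigPolyC4v) (d k j m : ℕ) : 0 ≤ klTowerMeasWtAt L M β U μ K d k j m := by
  unfold klTowerMeasWtAt
  rcases isEmpty_or_nonempty (Fin m × (SpaceTimeIdx L M × SectorLeg (sectorCount (d * k - 1)))) with h | h
  · rw [Real.iSup_of_isEmpty]
  · exact le_ciSup_of_le (Set.finite_range _).bddAbove (Classical.arbitrary _) (klWtPinnedSumAt_nonneg hβ μ K _ j m _ _ _)

/-! ## §2 The carrier majorant of the input pinned sums -/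

section Carrier

variable [NeZero M]

/-- `ε = imagTimeWeight β M = β/(2M) > 0` for `β > 0`. -/
theorem imagTimeWeight_pos_of_pos {β : ℝ} (hβ : 0 < β) : 0 < imagTimeWeight β M := by
  unfold imagTimeWeight
  have hM : (0 : ℝ) < M := Nat.cast_pos.2 (Nat.pos_of_ne_zero (NeZero.ne M))
  positivity

/-- **The carrier majorant satisfies p578846's `hB`**: every un-normalised rate-`j` weighted pinned sum of the input `𝒱_{dk}` at `F_{dk−1}` in degree `2m′` is at most
`klTowerMeasWtAt … d k j (2m′) / ε^{2m′−1}`. -/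
theorem towerInputMajorant_of_klTowerMeasWtAt {β : ℝ} (hβ : 0 < β) (U μ : ℝ) (K : TrigPolyC4v) (d k j m' : ℕ) (t : Fin (2 * m'))
    (w : SpaceTimeIdx L M × SectorLeg (sectorCount (d * k - 1))) :
    ∑ Y ∈ univ.filter (fun Y : Fin (2 * m') → SpaceTimeIdx L M × SectorLeg (sectorCount (d * k - 1)) => Y t = w),
        klScaleWt L M β j ((univ.image Y).image (latticeLegPos (2 * (2 * M)))) *
          ‖kernel ℂ (ExteriorAlgebra.map (Matrix.toLin' (sectorAnalysisMatrix L M β (klAnisoFamily L M β μ K klE0 (d * k - 1))))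
            (klTowerInput L M β U μ K d k)) (2 * m') Y‖ ≤
      klTowerMeasWtAt L M β U μ K d k j (2 * m') / imagTimeWeight β M ^ (2 * m' - 1) := by
  have hε := imagTimeWeight_pos_of_pos (M := M) hβ
  rw [le_div_iff₀ (pow_pos hε _), mul_comm]
  exact klWtPinnedSumAt_le_klTowerMeasWtAt β U μ K d k j (2 * m') t w

/-- The absolute kit sizes of the carrier majorant: `ε^{2m′}·(klTowerMeasWtAt … (2m′)/ε^{2m′−1}) = ε·klTowerMeasWtAt … (2m′)` (degree `0` by `klTowerMeasWtAt_zero`). -/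
theorem towerInputSizes_eq {β : ℝ} (hβ : 0 < β) (U μ : ℝ) (K : TrigPolyC4v) (d k j : ℕ) :
    (fun m' : ℕ => imagTimeWeight β M ^ (2 * m') * (klTowerMeasWtAt L M β U μ K d k j (2 * m') / imagTimeWeight β M ^ (2 * m' - 1))) =
      fun m' : ℕ => imagTimeWeight β M * klTowerMeasWtAt L M β U μ K d k j (2 * m') := by
  have hε := imagTimeWeight_pos_of_pos (M := M) hβ
  funext m'
  rcases Nat.eq_zero_or_pos m' with rfl | hm
  · simp [klTowerMeasWtAt_zero]
  · have h : imagTimeWeight β M ^ (2 * m') = imagTimeWeight β M ^ (2 * m' - 1) * imagTimeWeight β M := by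
      rw [← pow_succ]; congr 1; omega
    rw [h]; field_simp

/-! ## §3 The composed model Hstep on the carriers — binder version -/

/-- **THE MODEL Hstep IN KIT FORM ON THE CARRIERS (weighted track).**  Binders as `klWtPinnedSumAt_klTowerIncr_le_kit` (p578846's block data at rate `j`) WITHOUT the
input-size hypotheses (served by the carrier `klTowerMeasWtAt`), kit guard on the sizes `N m′ := ε·klTowerMeasWtAt … d k j (2m′)`:
`klTowerBornWtAt … d k j (2(q+1)) ≤ ε^{2q+1}·cr·cc^{2q+1}·(towerFO D κ² N (q+1) + Σ_{n∈Icc 2 (N₀−1)} e·Φ^{n−1}·ψ^{q+1}·towerS D τ N n (q+1) +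
ψ^{q+1}·e·towerV D τ N·(Φ·towerV D τ N)^{N₀−1}/(1 − Φ·towerV D τ N))`, `τ = (e²(κ+ρ))²`, `Φ = eα/κ²`, `ψ = ρ⁻²`. -/
theorem klTowerBornWtAt_le_kit {β : ℝ} (hβ : 0 < β) (U μ : ℝ) (K : TrigPolyC4v) {d k : ℕ} (j : ℕ) (hd : 1 ≤ d) (hk : 1 ≤ k)
    (hZ : hubbardEffPartitionFnCT L M β U μ 0 K (klScale klE0 (d * k)) ≠ 0)
    {κ : ℝ} (hκ : 0 < κ)
    (hGB : IsGramBoundedR ((sectorSubMatrix L M β (bgmFatMultiplier L M klE0 β (nambuXiCT L μ K) (d * k - 1))).transpose *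
      hubbardCovSliceCT L M β μ 0 K (klScale klE0 (d * (k + 1))) (klScale klE0 (d * k)) *
        sectorSubMatrix L M β (bgmFatMultiplier L M klE0 β (nambuXiCT L μ K) (d * k - 1))) κ)
    {α : ℝ} (hα : 0 < α)
    (hrow : ∀ X, ∑ Y, ‖((sectorSubMatrix L M β (bgmFatMultiplier L M klE0 β (nambuXiCT L μ K) (d * k - 1))).transpose *
        hubbardCovSliceCT L M β μ 0 K (klScale klE0 (d * (k + 1))) (klScale klE0 (d * k)) *
          sectorSubMatrix L M β (bgmFatMultiplier L M klE0 β (nambuXiCT L μ K) (d * k - 1))) X Y‖ *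
        klScaleWt L M β j {latticeLegPos (2 * (2 * M)) X, latticeLegPos (2 * (2 * M)) Y} ≤ α)
    (hcol : ∀ Y, ∑ X, ‖((sectorSubMatrix L M β (bgmFatMultiplier L M klE0 β (nambuXiCT L μ K) (d * k - 1))).transpose *
        hubbardCovSliceCT L M β μ 0 K (klScale klE0 (d * (k + 1))) (klScale klE0 (d * k)) *
          sectorSubMatrix L M β (bgmFatMultiplier L M klE0 β (nambuXiCT L μ K) (d * k - 1))) X Y‖ *
        klScaleWt L M β j {latticeLegPos (2 * (2 * M)) X, latticeLegPos (2 * (2 * M)) Y} ≤ α)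
    {ρ : ℝ} (hρ : 0 < ρ) {D : ℕ} (hD : Fintype.card (SpaceTimeIdx L M × SectorLeg (sectorCount (d * k - 1))) / 2 ≤ D)
    (hguard : Real.exp 1 * α / κ ^ 2 *
      towerV D ((Real.exp 2 * (κ + ρ)) ^ 2) (fun m' => imagTimeWeight β M * klTowerMeasWtAt L M β U μ K d k j (2 * m')) < 1)
    {cr cc : ℝ} (hcr0 : 0 ≤ cr) (hcc0 : 0 ≤ cc)
    (hrow' : ∀ X'', ∑ X', ‖(sectorAnalysisMatrix L M β (klAnisoFamily L M β μ K klE0 (d * k)) *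
        sectorSubMatrix L M β (bgmFatMultiplier L M klE0 β (nambuXiCT L μ K) (d * k - 1))) X'' X'‖ *
        klScaleWt L M β j {latticeLegPos (2 * (2 * M)) X'', latticeLegPos (2 * (2 * M)) X'} ≤ cr)
    (hcol' : ∀ X', ∑ X'', ‖(sectorAnalysisMatrix L M β (klAnisoFamily L M β μ K klE0 (d * k)) *
        sectorSubMatrix L M β (bgmFatMultiplier L M klE0 β (nambuXiCT L μ K) (d * k - 1))) X'' X'‖ *
        klScaleWt L M β j {latticeLegPos (2 * (2 * M)) X'', latticeLegPos (2 * (2 * M)) X'} ≤ cc)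
    {N₀ : ℕ} (hN₀ : 2 ≤ N₀) (q : ℕ) :
    klTowerBornWtAt L M β U μ K d k j (2 * (q + 1)) ≤
      imagTimeWeight β M ^ (2 * q + 1) *
        (cr * cc ^ (2 * q + 1) *
          (towerFO D (κ ^ 2) (fun m' => imagTimeWeight β M * klTowerMeasWtAt L M β U μ K d k j (2 * m')) (q + 1) +
            ∑ n ∈ Icc 2 (N₀ - 1), Real.exp 1 * (Real.exp 1 * α / κ ^ 2) ^ (n - 1) * (ρ⁻¹ ^ 2) ^ (q + 1) *
              towerS D ((Real.exp 2 * (κ + ρ)) ^ 2) (fun m' => imagTimeWeight β M * klTowerMeasWtAt L M β U μ K d k j (2 * m')) n (q + 1) +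
            (ρ⁻¹ ^ 2) ^ (q + 1) * Real.exp 1 *
              towerV D ((Real.exp 2 * (κ + ρ)) ^ 2) (fun m' => imagTimeWeight β M * klTowerMeasWtAt L M β U μ K d k j (2 * m')) *
              (Real.exp 1 * α / κ ^ 2 *
                towerV D ((Real.exp 2 * (κ + ρ)) ^ 2) (fun m' => imagTimeWeight β M * klTowerMeasWtAt L M β U μ K d k j (2 * m'))) ^ (N₀ - 1) /
              (1 - Real.exp 1 * α / κ ^ 2 *
                towerV D ((Real.exp 2 * (κ + ρ)) ^ 2) (fun m' => imagTimeWeight β M * klTowerMeasWtAt L M β U μ K d k j (2 * m'))))) := by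
  have hε := imagTimeWeight_pos_of_pos (M := M) hβ
  set B : ℕ → ℝ := fun m' => klTowerMeasWtAt L M β U μ K d k j (2 * m') / imagTimeWeight β M ^ (2 * m' - 1) with hBdef
  have hB0 : ∀ m', 0 ≤ B m' := fun m' => div_nonneg (klTowerMeasWtAt_nonneg hβ.le U μ K d k j _) (pow_nonneg hε.le _)
  have hB00 : B 0 = 0 := by simp [hBdef, klTowerMeasWtAt_zero]
  have hB : ∀ (m' : ℕ) (t : Fin (2 * m')) (w : SpaceTimeIdx L M × SectorLeg (sectorCount (d * k - 1))),
      ∑ Y ∈ univ.filter (fun Y : Fin (2 * m') → SpaceTimeIdx L M × SectorLeg (sectorCount (d * k - 1)) => Y t = w),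
        klScaleWt L M β j ((univ.image Y).image (latticeLegPos (2 * (2 * M)))) *
          ‖kernel ℂ (ExteriorAlgebra.map (Matrix.toLin' (sectorAnalysisMatrix L M β (klAnisoFamily L M β μ K klE0 (d * k - 1))))
            (klTowerInput L M β U μ K d k)) (2 * m') Y‖ ≤ B m' :=
    fun m' t w => towerInputMajorant_of_klTowerMeasWtAt hβ U μ K d k j m' t w
  have hNeq := towerInputSizes_eq (L := L) (M := M) hβ U μ K d k j
  -- the kit guard in `B`-form
  have hguard' : Real.exp 1 * α / κ ^ 2 *
      towerV D ((Real.exp 2 * (κ + ρ)) ^ 2) (fun m' => imagTimeWeight β M ^ (2 * m') * B m') < 1 := by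
    rw [hBdef]; rw [hNeq]; exact hguard
  -- pin by pin, then the supremum
  unfold klTowerBornWtAt
  rcases isEmpty_or_nonempty (Fin (2 * (q + 1)) × (SpaceTimeIdx L M × SectorLeg (sectorCount (d * k)))) with h | h
  · rw [Real.iSup_of_isEmpty]
    have hV0 : 0 ≤ towerV D ((Real.exp 2 * (κ + ρ)) ^ 2) (fun m' => imagTimeWeight β M * klTowerMeasWtAt L M β U μ K d k j (2 * m')) :=
      towerV_nonneg (by positivity) (fun m' => mul_nonneg hε.le (klTowerMeasWtAt_nonneg hβ.le U μ K d k j _))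
    have hFO0 : 0 ≤ towerFO D (κ ^ 2) (fun m' => imagTimeWeight β M * klTowerMeasWtAt L M β U μ K d k j (2 * m')) (q + 1) :=
      towerFO_nonneg (sq_nonneg κ) (fun m' => mul_nonneg hε.le (klTowerMeasWtAt_nonneg hβ.le U μ K d k j _)) _
    have hS0 : ∀ n, 0 ≤ towerS D ((Real.exp 2 * (κ + ρ)) ^ 2)
        (fun m' => imagTimeWeight β M * klTowerMeasWtAt L M β U μ K d k j (2 * m')) n (q + 1) := fun n =>
      towerS_nonneg (by positivity) (fun m' => mul_nonneg hε.le (klTowerMeasWtAt_nonneg hβ.le U μ K d k j _)) _ _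
    have h1 : 0 ≤ 1 - Real.exp 1 * α / κ ^ 2 *
        towerV D ((Real.exp 2 * (κ + ρ)) ^ 2) (fun m' => imagTimeWeight β M * klTowerMeasWtAt L M β U μ K d k j (2 * m')) :=
      sub_nonneg.2 hguard.le
    have hsum : 0 ≤ ∑ n ∈ Icc 2 (N₀ - 1), Real.exp 1 * (Real.exp 1 * α / κ ^ 2) ^ (n - 1) * (ρ⁻¹ ^ 2) ^ (q + 1) *
        towerS D ((Real.exp 2 * (κ + ρ)) ^ 2) (fun m' => imagTimeWeight β M * klTowerMeasWtAt L M β U μ K d k j (2 * m')) n (q + 1) :=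
      sum_nonneg fun n _ => by have := hS0 n; positivity
    positivity
  · refine ciSup_le fun iw => ?_
    have h := klWtPinnedSumAt_klTowerIncr_le_kit (L := L) (M := M) hβ U μ K j hd hk le_rfl hZ hκ hGB B hB0 hB00 hB hα hrow hcol hρ hD hguard'
      hcr0 hcc0 hrow' hcol' hN₀ q iw.1 iw.2
    rw [hBdef] at h; rw [hNeq] at h
    exact h

end Carrier

/-! ## §4 The composed model Hstep on the carriers — window-free flow-frame version -/

open Classical in
/-- **THE MODEL Hstep IN KIT FORM ON THE CARRIERS, FLOW FRAME, EVERY BLOCK, NO DEPTH WINDOW.**  `klWtPinnedSumAt_klTowerIncr_le_klEng_all_kit` with the input sizes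
served by the carrier `klTowerMeasWtAt` and the output taken to its supremum: under the binders of `klWtPinnedSumAt_klTowerIncr_le_klEng_all` (p633669; `κ, α, cr, cc`
by equational binders) and the kit guard on `N m′ := ε·klTowerMeasWtAt … d k j (2m′)`,
`klTowerBornWtAt … (K_n) d k j (2(q+1)) ≤ ε^{2q+1}·cr·cc^{2q+1}·(towerFO + kit graded + kit tail)`. -/
theorem klTowerBornWtAt_le_klEng_all_kit (d : ℕ) (R : RenConsts) (c'' : ℝ) (hc'' : 0 < c'') :
    ∃ Cκ Cb CJ CJ' : ℝ, 0 < Cκ ∧ 0 < Cb ∧ 0 < CJ ∧ 0 < CJ' ∧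
      ∀ (G : GeoConsts) (P : SplitConsts) (Q : EngConsts) (c : ℝ), P.WF → R.WF2 → 0 < c → c ≤ klEngC₃6 P R →
      ∀ μ ∈ klWindowC, ∀ U : ℝ, 0 < U → U ≤ klEngU₀9 P R c → c'' * U ≤ 1 →
      ∀ β : ℝ, klBetaMin ≤ β → β ≤ Real.exp (c / U ^ 2) →
      ∀ (L M : ℕ) [NeZero L] [NeZero M], klEngL₃ β U ≤ L → klEngM₃ β U L ≤ M →
      ∀ n : ℕ, 1 ≤ n → n ≤ nScales β + 1 → IsKLRegime U c (-(n : ℤ)) →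
        HistP klPredsV17F2 L M G P Q R β U μ 0 n → FrameOK R U (nScales β) μ (klFlowFrameU L M β U μ n) →
        (∀ m, 1 ≤ m → m < n → FlowPieceOscAt L M c'' β U μ m) →
      ∀ k : ℕ, 1 ≤ d → 1 ≤ k → 2 ≤ d * k → d * (k + 1) ≤ nScales β + 1 → d * k ≤ n → ∀ j : ℕ, d * k ≤ j →
      ∀ κ α cr cc : ℝ,
        κ = Real.sqrt (Cκ * (klScale klE0 (d * k) / klScale klE0 (d * k - 1)) * (klE0 * ((8 : ℝ) ^ (d * k - 1))⁻¹)) →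
        α = Cb * ((M : ℝ) / β) / klScale klE0 (d * (k + 1)) →
        cr = 81 * CJ * M / β → cc = 81 * (2 : ℝ) ^ (d * k - (d * k - 1)) * CJ' * M / β →
      hubbardEffPartitionFnCT L M β U μ 0 (klFlowFrameU L M β U μ n) (klScale klE0 (d * k)) ≠ 0 →
      ∀ ρ : ℝ, 0 < ρ → ∀ D : ℕ, Fintype.card (SpaceTimeIdx L M × SectorLeg (sectorCount (d * k - 1))) / 2 ≤ D →
        Real.exp 1 * α / κ ^ 2 * towerV D ((Real.exp 2 * (κ + ρ)) ^ 2)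
          (fun m' => imagTimeWeight β M * klTowerMeasWtAt L M β U μ (klFlowFrameU L M β U μ n) d k j (2 * m')) < 1 →
      ∀ N₀ : ℕ, 2 ≤ N₀ → ∀ q : ℕ,
      klTowerBornWtAt L M β U μ (klFlowFrameU L M β U μ n) d k j (2 * (q + 1)) ≤
        imagTimeWeight β M ^ (2 * q + 1) *
          (cr * cc ^ (2 * q + 1) *
            (towerFO D (κ ^ 2) (fun m' => imagTimeWeight β M * klTowerMeasWtAt L M β U μ (klFlowFrameU L M β U μ n) d k j (2 * m')) (q + 1) +
              ∑ n' ∈ Icc 2 (N₀ - 1), Real.exp 1 * (Real.exp 1 * α / κ ^ 2) ^ (n' - 1) * (ρ⁻¹ ^ 2) ^ (q + 1) *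
                towerS D ((Real.exp 2 * (κ + ρ)) ^ 2)
                  (fun m' => imagTimeWeight β M * klTowerMeasWtAt L M β U μ (klFlowFrameU L M β U μ n) d k j (2 * m')) n' (q + 1) +
              (ρ⁻¹ ^ 2) ^ (q + 1) * Real.exp 1 *
                towerV D ((Real.exp 2 * (κ + ρ)) ^ 2)
                  (fun m' => imagTimeWeight β M * klTowerMeasWtAt L M β U μ (klFlowFrameU L M β U μ n) d k j (2 * m')) *
                (Real.exp 1 * α / κ ^ 2 * towerV D ((Real.exp 2 * (κ + ρ)) ^ 2)
                  (fun m' => imagTimeWeight β M * klTowerMeasWtAt L M β U μ (klFlowFrameU L M β U μ n) d k j (2 * m'))) ^ (N₀ - 1) /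
                (1 - Real.exp 1 * α / κ ^ 2 * towerV D ((Real.exp 2 * (κ + ρ)) ^ 2)
                  (fun m' => imagTimeWeight β M * klTowerMeasWtAt L M β U μ (klFlowFrameU L M β U μ n) d k j (2 * m'))))) := by
  obtain ⟨Cκ, Cb, CJ, CJ', hCκ, hCb, hCJ, hCJ', hall⟩ := klWtPinnedSumAt_klTowerIncr_le_klEng_all_kit d R c'' hc''
  refine ⟨Cκ, Cb, CJ, CJ', hCκ, hCb, hCJ, hCJ', ?_⟩
  intro G P Q c hP hR2 hc hc6 μ hμ U hU hU9 hcU β hβmin hβc L M _ _ hL3 hM3 n hn1 hnN hreg hhist hfr hosc k hd hk hdk hdk1 hkn j hj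
    κ α cr cc hκ hα hcr hcc hZ ρ hρ D hD hguard N₀ hN₀ q
  have hβ : 0 < β := KLRegimeSplit.pos_of_klBetaMin_le hβmin
  have hM0 : (0 : ℝ) < M := Nat.cast_pos.2 (Nat.pos_of_ne_zero (NeZero.ne M))
  have he : (0 : ℝ) < klE0 := by norm_num [klE0]
  have hε := imagTimeWeight_pos_of_pos (M := M) hβ
  set K : TrigPolyC4v := klFlowFrameU L M β U μ n with hKdef
  have hκpos : 0 < κ := by
    rw [hκ]
    have h1 : 0 < klScale klE0 (d * k) := klth_klScale_pos _
    have h2 : 0 < klScale klE0 (d * k - 1) := klth_klScale_pos _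
    exact Real.sqrt_pos.2 (by positivity)
  have hΛpos : 0 < klScale klE0 (d * (k + 1)) := klth_klScale_pos _
  have hαpos : 0 < α := by rw [hα]; positivity
  have hcr0 : 0 ≤ cr := by rw [hcr]; positivity
  have hcc0 : 0 ≤ cc := by rw [hcc]; positivity
  set B : ℕ → ℝ := fun m' => klTowerMeasWtAt L M β U μ K d k j (2 * m') / imagTimeWeight β M ^ (2 * m' - 1) with hBdef
  have hB0 : ∀ m', 0 ≤ B m' := fun m' => div_nonneg (klTowerMeasWtAt_nonneg hβ.le U μ K d k j _) (pow_nonneg hε.le _)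
  have hB00 : B 0 = 0 := by simp [hBdef, klTowerMeasWtAt_zero]
  have hB : ∀ (m' : ℕ) (t : Fin (2 * m')) (w : SpaceTimeIdx L M × SectorLeg (sectorCount (d * k - 1))),
      ∑ Y ∈ univ.filter (fun Y : Fin (2 * m') → SpaceTimeIdx L M × SectorLeg (sectorCount (d * k - 1)) => Y t = w),
        klScaleWt L M β j ((univ.image Y).image (latticeLegPos (2 * (2 * M)))) *
          ‖kernel ℂ (ExteriorAlgebra.map (Matrix.toLin' (sectorAnalysisMatrix L M β (klAnisoFamily L M β μ K klE0 (d * k - 1))))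
            (klTowerInput L M β U μ K d k)) (2 * m') Y‖ ≤ B m' :=
    fun m' t w => towerInputMajorant_of_klTowerMeasWtAt hβ U μ K d k j m' t w
  have hNeq := towerInputSizes_eq (L := L) (M := M) hβ U μ K d k j
  have hguard' : Real.exp 1 * α / κ ^ 2 *
      towerV D ((Real.exp 2 * (κ + ρ)) ^ 2) (fun m' => imagTimeWeight β M ^ (2 * m') * B m') < 1 := by
    rw [hBdef]; rw [hNeq]; exact hguard
  unfold klTowerBornWtAt
  rcases isEmpty_or_nonempty (Fin (2 * (q + 1)) × (SpaceTimeIdx L M × SectorLeg (sectorCount (d * k)))) with h | h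
  · rw [Real.iSup_of_isEmpty]
    have hμ0 : ∀ m', 0 ≤ imagTimeWeight β M * klTowerMeasWtAt L M β U μ K d k j (2 * m') :=
      fun m' => mul_nonneg hε.le (klTowerMeasWtAt_nonneg hβ.le U μ K d k j _)
    have hV0 : 0 ≤ towerV D ((Real.exp 2 * (κ + ρ)) ^ 2) (fun m' => imagTimeWeight β M * klTowerMeasWtAt L M β U μ K d k j (2 * m')) :=
      towerV_nonneg (by positivity) hμ0
    have hFO0 : 0 ≤ towerFO D (κ ^ 2) (fun m' => imagTimeWeight β M * klTowerMeasWtAt L M β U μ K d k j (2 * m')) (q + 1) :=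
      towerFO_nonneg (sq_nonneg κ) hμ0 _
    have hS0 : ∀ n', 0 ≤ towerS D ((Real.exp 2 * (κ + ρ)) ^ 2)
        (fun m' => imagTimeWeight β M * klTowerMeasWtAt L M β U μ K d k j (2 * m')) n' (q + 1) := fun n' =>
      towerS_nonneg (by positivity) hμ0 _ _
    have h1 : 0 ≤ 1 - Real.exp 1 * α / κ ^ 2 *
        towerV D ((Real.exp 2 * (κ + ρ)) ^ 2) (fun m' => imagTimeWeight β M * klTowerMeasWtAt L M β U μ K d k j (2 * m')) :=
      sub_nonneg.2 hguard.le
    have hsum : 0 ≤ ∑ n' ∈ Icc 2 (N₀ - 1), Real.exp 1 * (Real.exp 1 * α / κ ^ 2) ^ (n' - 1) * (ρ⁻¹ ^ 2) ^ (q + 1) *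
        towerS D ((Real.exp 2 * (κ + ρ)) ^ 2) (fun m' => imagTimeWeight β M * klTowerMeasWtAt L M β U μ K d k j (2 * m')) n' (q + 1) :=
      sum_nonneg fun n' _ => by have := hS0 n'; positivity
    positivity
  · refine ciSup_le fun iw => ?_
    have h := hall G P Q c hP hR2 hc hc6 μ hμ U hU hU9 hcU β hβmin hβc L M hL3 hM3 n hn1 hnN hreg hhist hfr hosc k hd hk hdk hdk1 hkn j hj
      κ α cr cc hκ hα hcr hcc hZ B hB0 hB00 hB ρ hρ D hD hguard' N₀ hN₀ q iw.1 iw.2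
    rw [hBdef] at h; rw [hNeq] at h
    exact h

end Summit.HubbardSuperconductivity.HubbardSuperconductivity.Theorems.EngineV8

end
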